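import Mathlib
import HarnessLib
import HarnessLib.Audit.Tags

/-!
# QuantumFields / YangMills — single-scale plaquette-polymer activities are not small at weak coupling
(solo seat `solo-QuantumFields-informed`, session 3; the seat's PLAN.md §5 row 19, CLAIMS C6)

An elementary SCREEN for a recurring class of claimed proofs of the lattice Yang–Mills mass gap.
A single-scale polymer expansion in the plaquette activity `K_p(U) = W_p(U) - 1` of the Wilson
weight `W_p(U) = c · exp (β · f U)` (`f = Re tr ρ / N`, any normalisation `c > 0`) converges by the
Kotecký–Preiss criterion when `sup_U |K_p(U)|` is small — this is the strong-coupling (small `β`)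
cluster expansion of Osterwalder–Seiler, Ann. Phys. 110 (1978) 440, §§2–4. The claimed proof
arXiv:2506.00284 (2025; under no adjudication here beyond this remark) runs exactly this expansion
at LARGE `β`, asserting `sup |K_p| ≤ e^{-m}` with `m = O(β)` "for β ≫ 1" (its §4.2–4.3, App. A) and
convergence "for β > 630". The theorems below record why no such bound can hold under any
normalisation: two plaquette weights whose `f`-values differ by `δ` differ by the factor
`exp (β δ)`, and two positive numbers differing by a factor `> 3` cannot both lie within `1/2` of `1`
(`abs_sub_one_gt_half_of_three_mul_lt`). For the `SU(3)` Wilson weight `δ = 3/2` (identity versus a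
centre element: `f = Re tr / 3` takes the values `1` and `-1/2`), so `sup |K_p| > 1/2` for every `β ≥ 1`
(`plaquetteActivity_gt_half`), the Kotecký–Preiss ratio `12 e² · sup|K_p|` of loc. cit. App. A.3
(at most `(12e)ⁿ` connected polymers of size `n`, weight `eⁿ`) exceeds `44`
(`koteckyPreissRatio_gt`), and the majorising geometric series diverges
(`not_summable_koteckyPreiss_majorant`). Nothing here is specific to gauge theory; the point is
that the obstruction is normalisation-free and kernel-checked, so that the class "single-scale
plaquette-polymer expansion at weak coupling" can be screened mechanically.

No facts, no axioms beyond the standard three, no `sorry`.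
-/

namespace Summit.QuantumFields.YangMills.Theorems

open Real

/-! ### Two positive reals a factor `> 3` apart are not both within `1/2` of `1` -/

/-- If `3 b < a` then `|a - 1| > 1/2` or `|b - 1| > 1/2` (for `b > 0` this says: two positive reals a
factor `> 3` apart are not both within `1/2` of `1`). -/
theorem abs_sub_one_gt_half_of_three_mul_lt {a b : ℝ} (h : 3 * b < a) :
    1 / 2 < |a - 1| ∨ 1 / 2 < |b - 1| := by
  by_contra hcon
  push Not at hcon
  obtain ⟨ha, hb'⟩ := hcon
  have h1 : a ≤ 3 / 2 := by linarith [(abs_le.mp ha).2]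
  have h2 : 1 / 2 ≤ b := by linarith [(abs_le.mp hb').1]
  linarith

/-! ### The plaquette-activity obstruction -/

/-- For a weight `W = c · exp (β f)` with ANY normalisation `c > 0`: if `exp (β (f u - f v)) > 3`
for two configurations `u, v`, then `|W u - 1| > 1/2` or `|W v - 1| > 1/2`; in particular
`sup |W - 1| > 1/2`. -/
theorem plaquetteActivity_gt_half_of_exp_gt {G : Type*} (f : G → ℝ) {c β : ℝ} (hc : 0 < c)
    {u v : G} (h : 3 < Real.exp (β * (f u - f v))) :
    1 / 2 < |c * Real.exp (β * f u) - 1| ∨ 1 / 2 < |c * Real.exp (β * f v) - 1| := by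
  apply abs_sub_one_gt_half_of_three_mul_lt
  have hfac : c * Real.exp (β * f u)
      = (c * Real.exp (β * f v)) * Real.exp (β * (f u - f v)) := by
    rw [mul_assoc, ← Real.exp_add]; ring_nf
  rw [hfac]
  have hpos : 0 < c * Real.exp (β * f v) := by positivity
  nlinarith [hpos, h]

/-- `exp (3/2) > 3`: from `exp x ≥ 1 + x` at `x = 3/4`, squared. -/
theorem three_lt_exp_three_halves : (3 : ℝ) < Real.exp (3 / 2) := by
  have h := Real.add_one_le_exp (3 / 4 : ℝ)
  have hsq : Real.exp (3 / 2 : ℝ) = Real.exp (3 / 4) * Real.exp (3 / 4) := by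
    rw [← Real.exp_add]; norm_num
  rw [hsq]
  nlinarith [h, Real.exp_pos (3 / 4 : ℝ)]

/-- **The screen, quantitative form.** If the one-plaquette function `f` takes two values at least
`3/2` apart (the `SU(3)` Wilson case `f = Re tr / 3`: `f 1 = 1`, `f ω = -1/2` at a centre element `ω`)
and `β ≥ 1`, then under every normalisation `c > 0` the polymer activity `K = c · exp (β f) - 1` has
`sup |K| > 1/2`, witnessed at `u` or `v`. -/
theorem plaquetteActivity_gt_half {G : Type*} (f : G → ℝ) {c β : ℝ} (hc : 0 < c) (hβ : 1 ≤ β)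
    {u v : G} (huv : 3 / 2 ≤ f u - f v) :
    1 / 2 < |c * Real.exp (β * f u) - 1| ∨ 1 / 2 < |c * Real.exp (β * f v) - 1| := by
  apply plaquetteActivity_gt_half_of_exp_gt f hc
  calc (3 : ℝ) < Real.exp (3 / 2) := three_lt_exp_three_halves
    _ ≤ Real.exp (β * (f u - f v)) := by
        apply Real.exp_le_exp.mpr
        nlinarith [hβ, huv]

/-- The same for the tree's Wilson plaquette density `exp (-β (N - Re tr ρ(U_p)))` (the integrand of
`wilsonWeight` in `Literature/…/ConstructiveQFTWave0.lean`, one plaquette): for a matrix representation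
`ρ` and two group elements whose characters differ by at least `3/2` in real part (for `SU(3)`
fundamental: `Re tr 1 = 3`, `Re tr ω = -3/2`), at every `β ≥ 1` and under every normalisation `c > 0`
the plaquette activity exceeds `1/2` in absolute value at one of them. -/
theorem wilsonPlaquetteActivity_gt_half {G : Type*} [Group G] {N : ℕ}
    (ρ : G →* Matrix (Fin N) (Fin N) ℂ) {c β : ℝ} (hc : 0 < c) (hβ : 1 ≤ β) {u v : G}
    (huv : 3 / 2 ≤ (ρ u).trace.re - (ρ v).trace.re) :
    1 / 2 < |c * Real.exp (-β * ((N : ℝ) - (ρ u).trace.re)) - 1| ∨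
      1 / 2 < |c * Real.exp (-β * ((N : ℝ) - (ρ v).trace.re)) - 1| := by
  have h := plaquetteActivity_gt_half (fun g : G => (ρ g).trace.re - (N : ℝ)) hc hβ
    (u := u) (v := v) (by simpa using huv)
  have hu : -β * ((N : ℝ) - (ρ u).trace.re) = β * ((ρ u).trace.re - (N : ℝ)) := by ring
  have hv : -β * ((N : ℝ) - (ρ v).trace.re) = β * ((ρ v).trace.re - (N : ℝ)) := by ring
  rw [hu, hv]
  exact h

/-! ### Consequence for the Kotecký–Preiss bookkeeping of loc. cit. -/

/-- With at most `(12e)ⁿ` connected polymers of size `n` and Kotecký–Preiss weight `eⁿ` (`α = 1`),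
the convergence ratio is `12 e² · sup|K|`; once `sup |K| > 1/2` it exceeds `44`. -/
theorem koteckyPreissRatio_gt {s : ℝ} (hs : 1 / 2 < s) :
    44 < 12 * Real.exp 1 * Real.exp 1 * s := by
  have he : 2.7182818283 < Real.exp 1 := Real.exp_one_gt_d9
  have he0 : 0 < Real.exp 1 := Real.exp_pos 1
  nlinarith [he, he0, hs, mul_pos he0 he0]

/-- … and the majorising geometric series `∑ₙ (12e · e · sup|K|)ⁿ` diverges. -/
theorem not_summable_koteckyPreiss_majorant {s : ℝ} (hs : 1 / 2 < s) :
    ¬ Summable (fun n : ℕ => (12 * Real.exp 1 * Real.exp 1 * s) ^ n) := by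
  rw [summable_geometric_iff_norm_lt_one, Real.norm_eq_abs]
  have h := koteckyPreissRatio_gt hs
  have : (44 : ℝ) < |12 * Real.exp 1 * Real.exp 1 * s| := lt_of_lt_of_le h (le_abs_self _)
  linarith

/-- **Audit root of this file** (an item-free solo file exposes its content to the obligation-graph
audit as one proved proposition; same device as `AnatomyEquivalence` / `HandoverReduction`). It reads:
for every configuration space `G`, one-plaquette function `f` with two values at least `3/2` apart,
normalisation `c > 0` and coupling `β ≥ 1`, the polymer activity `c · exp (β f) - 1` exceeds `1/2` in
absolute value somewhere (abstractly, and for the tree's Wilson density `exp (-β (N - Re tr ρ U))`), and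
then the Kotecký–Preiss majorant `∑ₙ (12e · e · sup|K|)ⁿ` diverges — so no single-scale plaquette-polymer
expansion is in its Kotecký–Preiss regime at weak coupling. -/
abbrev PlaquetteActivityObstruction : Prop :=
  (∀ (G : Type) (f : G → ℝ) (c β : ℝ), 0 < c → 1 ≤ β → ∀ u v : G, 3 / 2 ≤ f u - f v →
      1 / 2 < |c * Real.exp (β * f u) - 1| ∨ 1 / 2 < |c * Real.exp (β * f v) - 1|) ∧
    (∀ (G : Type) [Group G] (N : ℕ) (ρ : G →* Matrix (Fin N) (Fin N) ℂ) (c β : ℝ), 0 < c → 1 ≤ β →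
      ∀ u v : G, 3 / 2 ≤ (ρ u).trace.re - (ρ v).trace.re →
        1 / 2 < |c * Real.exp (-β * ((N : ℝ) - (ρ u).trace.re)) - 1| ∨
          1 / 2 < |c * Real.exp (-β * ((N : ℝ) - (ρ v).trace.re)) - 1|) ∧
    ∀ s : ℝ, 1 / 2 < s → ¬ Summable (fun n : ℕ => (12 * Real.exp 1 * Real.exp 1 * s) ^ n)

/-- `PlaquetteActivityObstruction` holds: it is `plaquetteActivity_gt_half`, its Wilson-density form
`wilsonPlaquetteActivity_gt_half`, and `not_summable_koteckyPreiss_majorant`. -/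
theorem PlaquetteActivityObstruction_holds : PlaquetteActivityObstruction :=
  ⟨fun _G f _c _β hc hβ _u _v huv => plaquetteActivity_gt_half f hc hβ huv,
    fun _G _ _N ρ _c _β hc hβ _u _v huv => wilsonPlaquetteActivity_gt_half ρ hc hβ huv,
    fun _s hs => not_summable_koteckyPreiss_majorant hs⟩

end Summit.QuantumFields.YangMills.Theorems
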